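import Summits.ResolutionOfSingularities.ResolutionOfSingularities.Theorems.DescentDescentPerfectToAllFgModel
import Summits.ResolutionOfSingularities.ResolutionOfSingularities.Theorems.DescentDescentPerfectToAllRobustModel
import Literature.AlgebraicGeometry.Resolution.SmoothOfRegularPerfectField
import Literature.AlgebraicGeometry.Resolution.SmoothStalksRegular
import Mathlib.FieldTheory.PurelyInseparable.PerfectClosure
import HarnessLib

/-!
# Crux `PrimeModelTransfer` (stmt-ResolutionOfSingularities-8933), line `shared_climb_kernel`:
# stub `stub_descentToPerfectExtensions`

Route `ResolutionOfSingularities/UniformComplexity`, crux `PrimeModelTransfer` (resolution of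
integral separated finite-type schemes over the algebraically closed fields algebraic over `𝔽_p`
implies the same over every algebraically closed field of characteristic `p`). The registered
skeleton `Cruxes/PrimeModelTransfer/Lines/shared_climb_kernel.lean` (strategist r1, 2026-08-17)
proves `PrimeModelTransfer` from three stubs: the shared open kernel `stub_climbRatFuncPerf`
(verbatim the kernel of the sibling crux `UniversalCells.PrimeFieldToPerfect`, stmt-15233), the
tower `stub_towerFromPerfectBase`, and THIS stub.

**Statement (`stub_descentToPerfectExtensions`, registered signature verbatim).** Let `k₀` be a
field and `E ⊇ k₀` a PERFECT field. If, for every finite `s ⊆ E`, every integral separated scheme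
of finite type over the relative perfect closure `perfectClosure k₀(s) E` of `k₀(s)` inside `E`
admits a resolution of singularities, then so does every integral separated scheme of finite type
over `E`. Characteristic-free as stated (in characteristic `0` the perfect closure is `k₀(s)`
itself).

**Proof** — the landed `Theorems.PrimeFieldToPerfect.stub_separableDescent` (p149298) transposed
from "finitely generated field + abstract perfect closure" to "perfect closure of `k₀(s)` inside
`E`"; no new idea:
1. *Spreading out* (`Theorems.stub_fgModel`, EGA IV₃ 8.8.2): `X ≅ X₀ ×_{K₀} Spec E` for a subfield
   `K₀ = closure s ⊆ E`, `s` finite, and a separated finite-type `f₀ : X₀ → Spec K₀`.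
2. `L := perfectClosure k₀(s) E` contains `K₀` (as `s ⊆ k₀(s)`), and is perfect because `E` is
   (Mathlib `perfectClosure.perfectField`). Put `X_L := X₀ ×_{K₀} Spec L`.
3. `X ≅ X_L ×_L Spec E → X_L` is flat and surjective, so `X_L` is integral; by hypothesis it has a
   resolution `π : Y → X_L`.
4. `Y` is regular of finite type over the PERFECT field `L`, hence smooth over `L`
   (`smooth_of_isRegular_of_perfectField`); so `Y ×_L E` is smooth over `E`, hence regular
   (`isRegularLocalRing_stalk_of_smooth_of_field`) — the extension `E / L` is separable because
   `L` is perfect, which is the whole point of passing through `L`.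
5. `Theorems.stub_resolutionOfRobustModel`: the base change of `π` to `E` resolves
   `X₀ ×_{K₀} Spec E ≅ X`.

[OURS · LADDER-RESOLUTION L1, slot W8.2, kill test K8.2] A route stub of the summit's own route
UniformComplexity; it is NOT a statement of, and attributes nothing to, Hironaka's 2017 manuscript.

Sources: Q. Liu, *Algebraic Geometry and Arithmetic Curves* (2002), Prop. 3.2.7 and Cor. 4.3.33;
EGA IV₃ Thm. 8.8.2 (ii); Stacks Project 00TV, 056S. [cite: Liu2002, Prop. 3.2.7 and Cor. 4.3.33]
-/

noncomputable section

set_option linter.dupNamespace false -- mandated namespace of this single-conjunct summit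

open CategoryTheory CategoryTheory.Limits AlgebraicGeometry TopologicalSpace
open Literature.AlgebraicGeometry.Resolution

namespace Summit.ResolutionOfSingularities.ResolutionOfSingularities.Theorems.PrimeModelTransfer

/-- **Descent to the perfect closures of finitely generated subextensions** (stub
`stub_descentToPerfectExtensions` of crux `PrimeModelTransfer`, registered signature verbatim):
for a perfect field `E ⊇ k₀`, if integral separated finite-type schemes over
`perfectClosure k₀(s) E` are resolvable for every finite `s ⊆ E`, then so are those over `E`.
Proof: spread `X` out to `X₀ / K₀` with `K₀ = closure s ⊆ E`, resolve `X₀ ×_{K₀} L` over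
`L = perfectClosure k₀(s) E ⊇ K₀`, and base change along `E / L`; the regular source is smooth
over the perfect `L`, so it stays regular over `E`. [cite: Liu2002, Prop. 3.2.7 and Cor. 4.3.33] -/
theorem stub_descentToPerfectExtensions (k₀ : Type) [Field k₀]
    (E : Type) [Field E] [PerfectField E] [Algebra k₀ E]
    (h : ∀ (s : Finset E) (X : Scheme.{0})
      (f : X ⟶ Spec (.of (perfectClosure (IntermediateField.adjoin k₀ (↑s : Set E)) E))),
      IsSeparated f → LocallyOfFiniteType f → QuasiCompact f → IsIntegral X →
        Scheme.HasResolution X)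
    (X : Scheme.{0}) (f : X ⟶ Spec (.of E)) (hs : IsSeparated f) (hl : LocallyOfFiniteType f)
    (hq : QuasiCompact f) (hX : IsIntegral X) : Scheme.HasResolution X := by
  -- adapted from Theorems/UniversalCellsPrimeFieldToPerfectStubSeparableDescent.lean (p149298)
  classical
  -- ### Step 1: spread `X` out to a model `X₀` over a finitely generated subfield `K₀ ⊆ E`
  obtain ⟨K₀, s, hK₀, X₀, f₀, hsep, hlft, hqc, -, ⟨e⟩⟩ :=
    Summit.ResolutionOfSingularities.ResolutionOfSingularities.Theorems.stub_fgModel E X f hs hl hq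
      inferInstance
  -- ### Step 2: the relative perfect closure `L` of `k₀(s)` in `E`; it contains `K₀ = closure s`
  let F : IntermediateField k₀ E := IntermediateField.adjoin k₀ (↑s : Set E)
  let L : Subfield E := (perfectClosure F E).toSubfield
  have hL : K₀ ≤ L := by
    rw [hK₀]
    refine Subfield.closure_le.2 fun x hx => ?_
    have hxF : x ∈ F := IntermediateField.subset_adjoin k₀ (↑s : Set E) hx
    exact (perfectClosure F E).algebraMap_mem ⟨x, hxF⟩
  haveI : PerfectField L := inferInstanceAs (PerfectField (perfectClosure F E))
  -- ### Step 3: `X_L := X₀ ×_{K₀} Spec L` is integral, as `X ≅ X_L ×_L Spec E → X_L` is flat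
  -- and surjective
  let iL : Spec (.of L) ⟶ Spec (.of K₀) := Spec.map (CommRingCat.ofHom (Subfield.inclusion hL))
  let jL : Spec (.of E) ⟶ Spec (.of L) := Spec.map (CommRingCat.ofHom L.subtype)
  let XL : Scheme.{0} := pullback f₀ iL
  let gL : XL ⟶ Spec (.of L) := pullback.snd f₀ iL
  have hK : L.subtype.comp (Subfield.inclusion hL) = K₀.subtype := RingHom.ext fun _ => rfl
  have e' : jL ≫ iL = Spec.map (CommRingCat.ofHom K₀.subtype) := by
    rw [← Spec.map_comp, ← CommRingCat.ofHom_comp, hK]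
  let eK : pullback gL jL ≅ pullback f₀ (Spec.map (CommRingCat.ofHom K₀.subtype)) :=
    pullbackLeftPullbackSndIso f₀ iL jL ≪≫ pullback.congrHom rfl e'
  haveI : Flat jL := by
    rw [Flat.SpecMap_iff, CommRingCat.hom_ofHom]
    exact RingHom.flat_algebraMap_iff.mpr (inferInstance : Module.Flat L E)
  haveI : Surjective jL := by
    haveI : Subsingleton ↥(Spec (CommRingCat.of L)) :=
      inferInstanceAs (Subsingleton (PrimeSpectrum L))
    haveI : Nonempty ↥(Spec (CommRingCat.of E)) := inferInstanceAs (Nonempty (PrimeSpectrum E))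
    infer_instance
  let c : X ⟶ XL := e.hom ≫ eK.inv ≫ pullback.fst gL jL
  haveI : Flat c := inferInstance
  haveI : Surjective c := inferInstance
  haveI : IsIntegral XL := by
    haveI : IsReduced XL :=
      Literature.AlgebraicGeometry.Morphisms.isReduced_of_flat_of_surjective c
    haveI : IrreducibleSpace XL := c.surjective.irreducibleSpace c.continuous
    exact isIntegral_of_irreducibleSpace_of_isReduced XL
  -- ### Step 4: resolve `X_L` over `L = perfectClosure k₀(s) E` (the hypothesis at `s`)
  haveI : IsSeparated gL := inferInstance
  haveI : LocallyOfFiniteType gL := inferInstance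
  haveI : QuasiCompact gL := inferInstance
  obtain ⟨Y, π, hres⟩ := h s XL gL inferInstance inferInstance inferInstance inferInstance
  -- ### Step 5: `Y → Spec L` is smooth (regular over a perfect field), so `Y ×_L E` is regular
  haveI := hres.isProper
  haveI : Smooth (π ≫ gL) := smooth_of_isRegular_of_perfectField (π ≫ gL) hres.isRegular
  have hreg : Scheme.IsRegular (pullback (π ≫ gL) jL) := fun y =>
    isRegularLocalRing_stalk_of_smooth_of_field (pullback.snd (π ≫ gL) jL) y
  -- ### Step 6: base change the resolution to `E` and transport along `X ≅ X₀ ×_{K₀} Spec E`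
  have H :=
    Summit.ResolutionOfSingularities.ResolutionOfSingularities.Theorems.stub_resolutionOfRobustModel
      E K₀ L hL X₀ f₀ hsep hlft hqc Y π hres.isProper hres.isBirational hreg
  exact H.of_iso e.inv

end Summit.ResolutionOfSingularities.ResolutionOfSingularities.Theorems.PrimeModelTransfer

end
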